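import Literature.MathematicalPhysics.QuantumFieldTheory.VillainSheetDuality
import HarnessLib

/-!
# Bounds on the spin-wave (exact-part) kernel of the Villain cube: `0 ≤ E_n(δ_p) ≤ 1`, `|B_n(p,q)| ≤ 1`

Companion of `VillainSheetDuality`: the spin-wave factor of Fröhlich–Spencer's duality (FS82 §2.7
(2.51)–(2.54)) is governed by the quadratic form `E_T(σ) = ⟨σ, P_E σ⟩ = ‖P_E σ‖²` of the EXACT PART
`P_E = T M⁻¹ Tᵀ` (`T = dMat` the coboundary from free link angles to the plaquettes of the cube,
`M = TᵀT`), the orthogonal projection of real plaquette fields onto the exact ones ((2.50)–(2.52):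
`σ = dτ + ε_Λ`, `(ε_Λ, ε_Λ)` minimal).  Recorded here, for the consumers of the two-plaquette identity
`zdVillainExpect_im_mul_im_eq_spinWave_gas`:

* `exactEnergy_nonneg`, `exactEnergy_le_dotProduct_self`: `0 ≤ E_T(σ) ≤ ‖σ‖²` (projection);
* `bilin_eq_exactPart_apply`: the spin-wave bilinear form is a matrix element of the projection,
  `(Tᵀa)·(M⁻¹Tᵀb) = ⟨a, P_E b⟩`; for indicator sheets `B_n(p,q) = (P_E δ_q)(p)`;
* `exactEnergy_single_nonneg`, `exactEnergy_single_le_one`: `0 ≤ E_n(δ_p) ≤ 1`;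
* `sq_bilin_single_le`, `abs_bilin_single_le_one`: `B_n(p,q)² ≤ E_n(δ_q) ≤ 1`, so `|B_n(p,q)| ≤ 1`.

Hence in `⟨Im U_p Im U_q⟩_{B_n} = ½e^{−(E_p+E_q)/2β}(e^{B/β}A⁻ − e^{−B/β}A⁺)` the prefactors are uniformly
controlled: `e^{−1/β} ≤ e^{−(E_p+E_q)/2β} ≤ 1`, `e^{−1/β} ≤ e^{±B/β} ≤ e^{1/β}`.  Exact finite-volume
linear algebra; nothing asymptotic.  Everything is proved; no named fact is introduced.

## References

* J. Fröhlich, T. Spencer, Comm. Math. Phys. 83 (1982) 411–454, §2.7 (2.50)–(2.54) (the exact part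
  `dτ` of the sheet and the minimality of `(ε_Λ, ε_Λ)`). [FrohlichSpencerCMP1982]
-/

noncomputable section

open Finset Function Matrix
open scoped Real
open Literature.Probability.LatticeModels
open Literature.Probability.LatticeModels.GaussianCoord (exactPart perpPart exactEnergy)

namespace Literature.MathematicalPhysics.QuantumFieldTheory

namespace VillainAngle

open AxialGauge LatticeForm VillainFibre

variable {d n : ℕ}

/-! ### Generic: the exact-part quadratic form is that of an orthogonal projection -/

section Generic

variable {ι κ : Type*} [Fintype ι] [Fintype κ] [DecidableEq ι]

/-- `0 ≤ E_T(σ)` (it is `‖P_E σ‖²`). [cite: FrohlichSpencerCMP1982, §2.7 (2.52)] -/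
theorem exactEnergy_nonneg (T : Matrix κ ι ℝ)
    (hM : (Literature.Probability.LatticeModels.GaussianCoord.gram T).PosDef) (σ : κ → ℝ) :
    0 ≤ exactEnergy T σ := by
  rw [← exactPart_dotProduct_self T hM σ]
  exact Finset.sum_nonneg fun i _ => mul_self_nonneg _

/-- `E_T(σ) ≤ ‖σ‖²` (the exact part is the nearest exact field; compare with the competitor `0`).
[cite: FrohlichSpencerCMP1982, §2.7 (2.51)–(2.52)] -/
theorem exactEnergy_le_dotProduct_self (T : Matrix κ ι ℝ)
    (hM : (Literature.Probability.LatticeModels.GaussianCoord.gram T).PosDef) (σ : κ → ℝ) :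
    exactEnergy T σ ≤ σ ⬝ᵥ σ := by
  have h := exactEnergy_le_dotProduct_sub T hM σ 0 (Matrix.mulVec_zero _)
  rwa [sub_zero] at h

/-- **The spin-wave bilinear form is a matrix element of the exact-part projection**:
`(Tᵀa)·(M⁻¹Tᵀb) = ⟨a, P_E b⟩`. [cite: FrohlichSpencerCMP1982, §2.7 (2.50)–(2.52)] -/
theorem bilin_eq_dotProduct_exactPart (T : Matrix κ ι ℝ) (a b : κ → ℝ) :
    (Tᵀ *ᵥ a) ⬝ᵥ ((Literature.Probability.LatticeModels.GaussianCoord.gram T)⁻¹ *ᵥ (Tᵀ *ᵥ b)) =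
      a ⬝ᵥ exactPart T b := by
  rw [exactPart, dotProduct_comm a, GaussianCoord.mulVec_dotProduct_eq, Matrix.transpose_transpose,
    dotProduct_comm]

/-- For an indicator `a = δ_p`: `(Tᵀδ_p)·(M⁻¹Tᵀb) = (P_E b)(p)`. [cite: FrohlichSpencerCMP1982, §2.7 (2.50)–(2.52)] -/
theorem bilin_single_eq_exactPart_apply [DecidableEq κ] (T : Matrix κ ι ℝ) (p : κ) (b : κ → ℝ) :
    (Tᵀ *ᵥ (Pi.single p (1 : ℝ) : κ → ℝ)) ⬝ᵥ
        ((Literature.Probability.LatticeModels.GaussianCoord.gram T)⁻¹ *ᵥ (Tᵀ *ᵥ b)) =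
      exactPart T b p := by
  rw [bilin_eq_dotProduct_exactPart, dotProduct_comm, dotProduct_single, mul_one]

/-- `(P_E b)(p)² ≤ E_T(b)` (one coordinate of `P_E b` against its whole norm).
[cite: FrohlichSpencerCMP1982, §2.7 (2.52)] -/
theorem sq_exactPart_apply_le (T : Matrix κ ι ℝ)
    (hM : (Literature.Probability.LatticeModels.GaussianCoord.gram T).PosDef) (b : κ → ℝ) (p : κ) :
    exactPart T b p ^ 2 ≤ exactEnergy T b := by
  rw [← exactPart_dotProduct_self T hM b, dotProduct, sq]
  exact Finset.single_le_sum (f := fun i => exactPart T b i * exactPart T b i)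
    (fun i _ => mul_self_nonneg _) (Finset.mem_univ p)

end Generic

/-! ### The cube: indicator sheets -/

/-- `0 ≤ E_n(δ_p)`. [cite: FrohlichSpencerCMP1982, §2.7 (2.52)] -/
theorem exactEnergy_single_nonneg (p : PIdx d n) :
    0 ≤ exactEnergy dMat (Pi.single p (1 : ℝ) : PIdx d n → ℝ) :=
  exactEnergy_nonneg dMat posDef_gram_dMat _

/-- **`E_n(δ_p) ≤ 1`**: the spin-wave energy of a single plaquette is at most `‖δ_p‖² = 1`.
[cite: FrohlichSpencerCMP1982, §2.7 (2.51)–(2.52)] -/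
theorem exactEnergy_single_le_one (p : PIdx d n) :
    exactEnergy dMat (Pi.single p (1 : ℝ) : PIdx d n → ℝ) ≤ 1 := by
  refine (exactEnergy_le_dotProduct_self dMat posDef_gram_dMat _).trans (le_of_eq ?_)
  rw [dotProduct_single, Pi.single_eq_same, mul_one]

/-- **`B_n(p,q)² ≤ E_n(δ_q)`** for the spin-wave bilinear form of two indicator sheets.
[cite: FrohlichSpencerCMP1982, §2.7 (2.52)] -/
theorem sq_bilin_single_le (p q : PIdx d n) :
    ((dMatᵀ *ᵥ (Pi.single p (1 : ℝ) : PIdx d n → ℝ)) ⬝ᵥ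
        ((Literature.Probability.LatticeModels.GaussianCoord.gram (dMat (d := d) (n := n)))⁻¹ *ᵥ
          (dMatᵀ *ᵥ (Pi.single q (1 : ℝ) : PIdx d n → ℝ)))) ^ 2 ≤
      exactEnergy dMat (Pi.single q (1 : ℝ) : PIdx d n → ℝ) := by
  rw [bilin_single_eq_exactPart_apply]
  exact sq_exactPart_apply_le dMat posDef_gram_dMat _ p

/-- **`|B_n(p,q)| ≤ 1`**: the spin-wave bilinear form of two indicator sheets is a matrix element of an
orthogonal projection. [cite: FrohlichSpencerCMP1982, §2.7 (2.50)–(2.52)] -/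
theorem abs_bilin_single_le_one (p q : PIdx d n) :
    |(dMatᵀ *ᵥ (Pi.single p (1 : ℝ) : PIdx d n → ℝ)) ⬝ᵥ
        ((Literature.Probability.LatticeModels.GaussianCoord.gram (dMat (d := d) (n := n)))⁻¹ *ᵥ
          (dMatᵀ *ᵥ (Pi.single q (1 : ℝ) : PIdx d n → ℝ)))| ≤ 1 := by
  rw [← sq_le_one_iff_abs_le_one]
  exact (sq_bilin_single_le p q).trans (exactEnergy_single_le_one q)

end VillainAngle

end Literature.MathematicalPhysics.QuantumFieldTheory
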